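import Mathlib.NumberTheory.JacobiSum.Basic
import Literature.RepresentationTheory.FiniteGroups.GL2ModularPrincipalSeriesTorusLines
import HarnessLib

/-!
# The `χ`-twisting operator `T_χ = Σ_a χ(a)·u(a)` on the principal series `𝓑(χ₁, χ₂)` of `GL₂(F)`:
# it carries the torus line `φ_θ` to `χ(−1)·J(θ, χ)·φ_{θχ}` (Jacobi-sum coefficient)

Topic `Literature/RepresentationTheory/FiniteGroups`, namespace `Literature.RepresentationTheory.FiniteGroups.GL2`
(sequel of `GL2ModularPrincipalSeriesTorusLines`).  DEFINITION (`twistOp`) + API (reviewed kind); no named fact, no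
instance, no notation, no `sorry`.  `F : Type` a finite field, `k` a commutative coefficient ring (a domain where
vanishing of nontrivial character sums is used).

For a multiplicative character `χ` of `F` with values in `k`, the `χ`-weighted unipotent average
`T_χ := Σ_{a ∈ F} χ(a)·𝓑(u(a))`, `u(a) = (1 a; 0 1)`, is a `k`-linear endomorphism of `𝓑(χ₁, χ₂) = Ind_B^G(χ₁ ⊗ χ₂)`
(over ANY commutative `k`, in particular on the integral structure `Fun_{ℤ_p}(Ind)` and on its reduction).  Since
`diag(a,b) u(s) diag(a,b)⁻¹ = u(as/b)`, `T_χ` is `χ(b/a)`-semi-invariant under the diagonal torus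
(`diagElt_comp_twistOp`), so it permutes the torus eigen-lines of `GL2ModularPrincipalSeriesTorusLines`; on the
line function `φ_θ` (`φ_θ(w u(t)) = θ(t)`) it acts by the classical character-sum identity
`Σ_a χ(a) θ(t + a) = χ(−1) J(θ, χ) (θχ)(t)` with `J(θ, χ) = Σ_z θ(z)χ(1 − z)` the JACOBI SUM [IrelandRosen1990, Ch. 8
§3] (substitute `a = tz − t`):

* `twistOp χ₁ χ₂ χ`, `twistOp_apply`, `coe_twistOp_apply`, `twistOp_apply_one` (`(T_χ f)(1) = (Σ_a χ(a)) f(1)`, `= 0`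
  for `χ ≠ 1`), `twistOp_apply_weyl_upperUnip` (`(T_χ f)(w u(t)) = Σ_a χ(a) f(w u(t+a))`);
* **`diagElt_comp_twistOp`**: `𝓑(diag(a,b)) ∘ T_χ = χ(b/a) · T_χ ∘ 𝓑(diag(a,b))`;
* **`twistOp_torusFun`**: `T_χ φ_θ = χ(−1)·J(θ, χ)·φ_{θχ}` (`θχ ≠ 1`, `k` a domain), and the line form
  `map_twistOp_span_torusFun`: `T_χ(k·φ_θ) = k·(χ(−1)J(θ,χ)·φ_{θχ})`;
* for a trivial central character `χ₁χ₂ = 1` and a quadratic `χ ∉ {χ₁, χ₂}` (the tame type `Ind(η ⊗ η⁻¹)` and the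
  quadratic twist): **`map_twistOp_torusInvariants`** `T_χ(𝓑^T) = k·(±J(χ₂, χ)·φ_{χ₂χ}) ⊆ 𝓑^{T, χ∘det}` and
  **`map_twistOp_torusEigenspace_quadratic`** `T_χ(𝓑^{T,χ∘det}) = k·(±J(χ₂χ, χ)·φ_{χ₂}) ⊆ 𝓑^T` — the two
  «indices of the twisting operator between the torus lines» are the principal ideals generated by the Jacobi sums
  `J(χ₂, χ)` and `J(χ₂χ, χ)` (for `p`-adic Teichmüller powers their valuations are Stickelberger's, see the tree's
  `Literature.NumberTheory.GaussSums.norm_jacobiSum_eq_one_of_lt_add` / `…_eq_inv_of_add_lt`).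

The same character-sum identity is proved on the Summits side in
`Summit.…TeichmullerTwistDescent.TwistOperatorFiniteModel.sum_mul_apply_add` (route helper, not importable from
`Literature`); here it is an internal step of `twistOp_torusFun`.
-/

noncomputable section

namespace Literature.RepresentationTheory.FiniteGroups

namespace GL2

open Matrix Finset

/-! ## The character-sum identity behind the twisting operator -/
section JacobiIdentity

variable {F : Type} [Field F] [Fintype F] {k : Type*} [CommRing k]

/-- `Σ_a χ(a)·θ(x + a) = χ(−1)·J(θ, χ)·(θχ)(x)` for `x ≠ 0` (substitute `a = x z − x`):
the Jacobi sum as the eigenvalue of the `χ`-weighted translation average on multiplicative characters.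
[cite: IrelandRosen1990, Ch. 8 §3 Thm. 1] -/
theorem sum_mulChar_mul_apply_add_of_ne_zero (χ θ : MulChar F k) {x : F} (hx : x ≠ 0) :
    ∑ a, χ a * θ (x + a) = χ (-1) * jacobiSum θ χ * (θ * χ) x := by
  let e : F ≃ F := (Equiv.mulLeft₀ x hx).trans (Equiv.subRight x)
  have he : ∀ z : F, e z = x * z - x := fun z => rfl
  rw [← Equiv.sum_comp e (fun a => χ a * θ (x + a))]
  have key : ∀ z : F, χ (e z) * θ (x + e z) = χ (-1) * (θ x * χ x) * (θ z * χ (1 - z)) := by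
    intro z
    have h1 : x + e z = x * z := by rw [he]; ring
    have h2 : e z = (-1) * (x * (1 - z)) := by rw [he]; ring
    rw [h1, h2, map_mul, map_mul, map_mul]
    ring
  simp_rw [key]
  rw [← mul_sum, jacobiSum, MulChar.coeToFun_mul, Pi.mul_apply]
  ring

/-- `Σ_a χ(a)·θ(x + a) = χ(−1)·J(θ, χ)·(θχ)(x)` for all `x` when `θχ ≠ 1` (at `x = 0` both sides vanish: a
nontrivial character sums to zero over a domain). [cite: IrelandRosen1990, Ch. 8 §3 Thm. 1] -/
theorem sum_mulChar_mul_apply_add [IsDomain k] (χ θ : MulChar F k) (hθχ : θ * χ ≠ 1) (x : F) :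
    ∑ a, χ a * θ (x + a) = χ (-1) * jacobiSum θ χ * (θ * χ) x := by
  by_cases hx : x = 0
  · subst hx
    simp_rw [zero_add]
    rw [MulChar.map_nonunit (θ * χ) not_isUnit_zero, mul_zero]
    have : ∑ a, χ a * θ a = ∑ a, (θ * χ) a := by
      refine sum_congr rfl fun a _ => ?_
      rw [MulChar.coeToFun_mul, Pi.mul_apply, mul_comm]
    rw [this, MulChar.sum_eq_zero_of_ne_one hθχ]
  · exact sum_mulChar_mul_apply_add_of_ne_zero χ θ hx

end JacobiIdentity

/-! ## The twisting operator -/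
section TwistOp

variable {F : Type} [Field F] [Fintype F] {k : Type*} [CommRing k] (χ₁ χ₂ : Fˣ →* kˣ)

/-- **The `χ`-twisting operator** `T_χ = Σ_{a ∈ F} χ(a)·𝓑(u(a))` on `𝓑(χ₁, χ₂)`, a `k`-linear endomorphism
(the finite-group shadow of the twisting operator `Σ_u χ(u)·(1 u/p; 0 1)` on modular symbols / of `f ↦ f ⊗ χ`).
[cite: Bump1997, §4.1 Eq. (1.7)] -/
def twistOp (χ : MulChar F k) :
    Representation.coindV (borel F).subtype (scalarRep (borelCharacter F χ₁ χ₂)) →ₗ[k]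
      Representation.coindV (borel F).subtype (scalarRep (borelCharacter F χ₁ χ₂)) :=
  ∑ a : F, χ a • principalSeriesRep F χ₁ χ₂ (upperUnip F a)

/-- Unfolding: `T_χ f = Σ_a χ(a)·(u(a)·f)`. [cite: Bump1997, §4.1 Eq. (1.7)] -/
theorem twistOp_apply (χ : MulChar F k)
    (f : Representation.coindV (borel F).subtype (scalarRep (borelCharacter F χ₁ χ₂))) :
    twistOp χ₁ χ₂ χ f = ∑ a : F, χ a • principalSeriesRep F χ₁ χ₂ (upperUnip F a) f := by
  rw [twistOp, LinearMap.sum_apply]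
  rfl

/-- Pointwise: `(T_χ f)(x) = Σ_a χ(a) f(x u(a))`. [cite: Bump1997, §4.1 Eq. (1.7)] -/
theorem coe_twistOp_apply (χ : MulChar F k)
    (f : Representation.coindV (borel F).subtype (scalarRep (borelCharacter F χ₁ χ₂))) (x : GL (Fin 2) F) :
    (twistOp χ₁ χ₂ χ f : GL (Fin 2) F → k) x =
      ∑ a : F, χ a * (f : GL (Fin 2) F → k) (x * upperUnip F a) := by
  rw [twistOp_apply, AddSubmonoidClass.coe_finsetSum, Finset.sum_apply]
  refine sum_congr rfl fun a _ => ?_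
  rw [Submodule.coe_smul, Pi.smul_apply, smul_eq_mul, principalSeriesRep_apply_coe]

/-- `(T_χ f)(1) = (Σ_a χ(a))·f(1)`. [cite: Bump1997, §4.1 Eq. (1.7)] -/
theorem twistOp_apply_one (χ : MulChar F k)
    (f : Representation.coindV (borel F).subtype (scalarRep (borelCharacter F χ₁ χ₂))) :
    (twistOp χ₁ χ₂ χ f : GL (Fin 2) F → k) 1 = (∑ a : F, χ a) * (f : GL (Fin 2) F → k) 1 := by
  rw [coe_twistOp_apply, sum_mul]
  refine sum_congr rfl fun a _ => ?_
  rw [← principalSeriesRep_apply_coe, upperUnip_smul_apply_one]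

/-- `(T_χ f)(1) = 0` for `χ ≠ 1` over a domain. [cite: Bump1997, §4.1 Eq. (1.7)] -/
theorem twistOp_apply_one_eq_zero [IsDomain k] {χ : MulChar F k} (hχ : χ ≠ 1)
    (f : Representation.coindV (borel F).subtype (scalarRep (borelCharacter F χ₁ χ₂))) :
    (twistOp χ₁ χ₂ χ f : GL (Fin 2) F → k) 1 = 0 := by
  rw [twistOp_apply_one, MulChar.sum_eq_zero_of_ne_one hχ, zero_mul]

/-- `(T_χ f)(w u(t)) = Σ_a χ(a) f(w u(t + a))`: in the big-cell coordinate `T_χ` is the `χ`-weighted translation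
average. [cite: Bump1997, §4.1 Eq. (1.7)] -/
theorem twistOp_apply_weyl_upperUnip (χ : MulChar F k)
    (f : Representation.coindV (borel F).subtype (scalarRep (borelCharacter F χ₁ χ₂))) (t : F) :
    (twistOp χ₁ χ₂ χ f : GL (Fin 2) F → k) (weyl F * upperUnip F t) =
      ∑ a : F, χ a * (f : GL (Fin 2) F → k) (weyl F * upperUnip F (t + a)) := by
  rw [coe_twistOp_apply]
  refine sum_congr rfl fun a _ => ?_
  rw [weyl_mul_upperUnip_mul_upperUnip]

/-- **Torus semi-invariance of `T_χ`**: `𝓑(diag(a,b)) ∘ T_χ = χ(b/a) · T_χ ∘ 𝓑(diag(a,b))` (products in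
`End_k 𝓑(χ₁, χ₂)`), because `diag(a,b) u(s) = u(as/b) diag(a,b)` and `Σ_s χ(s) u(as/b) = χ(b/a) Σ_s χ(s) u(s)`.
Consequently `T_χ` maps the `T`-eigenspace with eigencharacter `ε` to the one with eigencharacter
`ε · (χ⁻¹ ⊗ χ)`. [cite: Bump1997, §4.1 Eq. (1.7)] -/
theorem diagElt_mul_twistOp (χ : MulChar F k) (a b : Fˣ) :
    principalSeriesRep F χ₁ χ₂ (diagElt F a b) * twistOp χ₁ χ₂ χ =
      χ ((b : F) / a) • (twistOp χ₁ χ₂ χ * principalSeriesRep F χ₁ χ₂ (diagElt F a b)) := by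
  have hc : (a : F) / b ≠ 0 := div_ne_zero a.ne_zero b.ne_zero
  rw [twistOp, Finset.mul_sum, Finset.sum_mul, Finset.smul_sum]
  simp_rw [mul_smul_comm, smul_mul_assoc, ← map_mul, diagElt_mul_upperUnip]
  have hre : ∀ s : F, (a : F) * s / b = s * ((a : F) / b) := fun s => by ring
  simp_rw [hre]
  refine Fintype.sum_equiv (Equiv.mulRight₀ ((a : F) / b) hc) _ _ fun s => ?_
  simp only [Equiv.mulRight₀_apply]
  rw [smul_smul, ← map_mul]
  congr 2
  field_simp

/-- `T_χ` carries `T`-eigenvectors to `T`-eigenvectors: if `diag(a,b)·f = ε(a,b)·f` for all `a, b` then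
`diag(a,b)·(T_χ f) = χ(b/a)ε(a,b)·(T_χ f)`. [cite: Bump1997, §4.1 Eq. (1.7)] -/
theorem twistOp_mem_torusEigenspace (χ : MulChar F k) {ε : Fˣ → Fˣ → k}
    {f : Representation.coindV (borel F).subtype (scalarRep (borelCharacter F χ₁ χ₂))}
    (hf : f ∈ torusEigenspace χ₁ χ₂ ε) :
    twistOp χ₁ χ₂ χ f ∈ torusEigenspace χ₁ χ₂ fun a b => χ ((b : F) / a) * ε a b := by
  intro a b
  have h := congrArg (fun T => T f) (diagElt_mul_twistOp χ₁ χ₂ χ a b)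
  simp only [Module.End.mul_apply, LinearMap.smul_apply] at h
  rw [h, hf a b, map_smul, smul_smul]

end TwistOp

/-! ## The twisting operator on the torus lines -/
section TwistTorus

variable {F : Type} [Field F] [Fintype F] [DecidableEq F] {k : Type*} [CommRing k] [IsDomain k]
  (χ₁ χ₂ : Fˣ →* kˣ)

/-- **`T_χ φ_θ = χ(−1)·J(θ, χ)·φ_{θχ}`** (`θχ ≠ 1`, `k` a domain): the twisting operator carries the torus line
of `θ` to the torus line of `θχ` with coefficient the Jacobi sum `J(θ, χ)` (up to the sign `χ(−1)`) — in Bruhat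
coordinates this is `Σ_a χ(a) θ(t + a) = χ(−1) J(θ, χ) (θχ)(t)`. [cite: IrelandRosen1990, Ch. 8 §3 Thm. 1] -/
theorem twistOp_torusFun (χ θ : MulChar F k) (hθχ : θ * χ ≠ 1) :
    twistOp χ₁ χ₂ χ (torusFun χ₁ χ₂ θ) = (χ (-1) * jacobiSum θ χ) • torusFun χ₁ χ₂ (θ * χ) := by
  refine ext_of_bruhatEval χ₁ χ₂ ?_ fun t => ?_
  · rw [twistOp_apply_one, torusFun_apply_one, mul_zero, Submodule.coe_smul, Pi.smul_apply, torusFun_apply_one,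
      smul_eq_mul, mul_zero]
  · rw [twistOp_apply_weyl_upperUnip, Submodule.coe_smul, Pi.smul_apply, torusFun_apply_weyl_upperUnip,
      smul_eq_mul]
    simp_rw [torusFun_apply_weyl_upperUnip]
    exact sum_mulChar_mul_apply_add χ θ hθχ t

/-- Line form: `T_χ (k·φ_θ) = k·(χ(−1)J(θ,χ)·φ_{θχ})`. [cite: IrelandRosen1990, Ch. 8 §3 Thm. 1] -/
theorem map_twistOp_span_torusFun (χ θ : MulChar F k) (hθχ : θ * χ ≠ 1) :
    (k ∙ torusFun χ₁ χ₂ θ).map (twistOp χ₁ χ₂ χ) = k ∙ ((χ (-1) * jacobiSum θ χ) • torusFun χ₁ χ₂ (θ * χ)) := by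
  rw [Submodule.map_span, Set.image_singleton, twistOp_torusFun χ₁ χ₂ χ θ hθχ]

omit [Fintype F] [DecidableEq F] [IsDomain k] in
/-- For `χ₁χ₂ = 1`: `χ₂χ ≠ 1` as soon as `χ ≠ χ₁`. [cite: Bump1997, §4.1 Thm. 4.1.1 (proof)] -/
theorem ofUnitHom_mul_ne_one (h12 : χ₁ * χ₂ = 1) {χ : MulChar F k} (hχ1 : χ ≠ MulChar.ofUnitHom χ₁) :
    MulChar.ofUnitHom χ₂ * χ ≠ 1 := by
  have hb1 : ∀ b : Fˣ, (χ₁ b : k) * (χ₂ b : k) = 1 := fun b => by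
    rw [← Units.val_mul, ← MonoidHom.mul_apply, h12, MonoidHom.one_apply, Units.val_one]
  intro h
  apply hχ1
  refine MulChar.ext fun a => ?_
  have h' := congrArg (fun ψ : MulChar F k => ψ (a : F)) h
  simp only [MulChar.coeToFun_mul, Pi.mul_apply, ofUnitHom_apply_coe, MulChar.one_apply_coe] at h'
  rw [ofUnitHom_apply_coe]
  calc χ (a : F) = ((χ₁ a : k) * (χ₂ a : k)) * χ (a : F) := by rw [hb1, one_mul]
    _ = (χ₁ a : k) := by rw [mul_assoc, h', mul_one]

omit [Fintype F] [DecidableEq F] [IsDomain k] in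
/-- For `χ₁χ₂ = 1` with `χ₁ ≠ 1`: `ofUnitHom χ₂ ≠ 1`. [cite: Bump1997, §4.1 Thm. 4.1.1 (proof)] -/
theorem ofUnitHom_ne_one (h12 : χ₁ * χ₂ = 1) (h1 : χ₁ ≠ 1) : MulChar.ofUnitHom χ₂ ≠ (1 : MulChar F k) := by
  have hχ₂ : χ₂ ≠ 1 := by
    rintro rfl
    apply h1
    ext a
    simpa using DFunLike.congr_fun h12 a
  obtain ⟨a, ha⟩ := exists_coe_apply_ne_one (F := F) hχ₂
  exact MulChar.ne_one_iff.mpr ⟨a, by rwa [ofUnitHom_apply_coe]⟩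

/-- **The twisting operator on the `T`-invariant line** of the type `𝓑(χ₁, χ₁⁻¹)` (`χ₁χ₂ = 1`, `χ₁ ≠ 1`): for
`χ ≠ χ₁`, `T_χ(𝓑^T) = T_χ(k·φ_{χ₂}) = k·(χ(−1)J(χ₂, χ)·φ_{χ₂χ})` — a submodule of the `χ∘det`-eigen-line
`k·φ_{χ₂χ}` of «index» the principal ideal `(J(χ₂, χ))`. [cite: IrelandRosen1990, Ch. 8 §3 Thm. 1] -/
theorem map_twistOp_torusInvariants (h12 : χ₁ * χ₂ = 1) (h1 : χ₁ ≠ 1) {χ : MulChar F k}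
    (hχ1 : χ ≠ MulChar.ofUnitHom χ₁) :
    (torusEigenspace χ₁ χ₂ fun _ _ => (1 : k)).map (twistOp χ₁ χ₂ χ) =
      k ∙ ((χ (-1) * jacobiSum (MulChar.ofUnitHom χ₂) χ) • torusFun χ₁ χ₂ (MulChar.ofUnitHom χ₂ * χ)) := by
  rw [torusInvariants_eq_span χ₁ χ₂ h12 h1,
    map_twistOp_span_torusFun χ₁ χ₂ χ _ (ofUnitHom_mul_ne_one χ₁ χ₂ h12 hχ1)]

/-- **The twisting operator on the `χ∘det`-eigen-line** (`χ₁χ₂ = 1`, `χ₁ ≠ 1`, `χ` quadratic, `χ ∉ {χ₁, χ₂}`):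
`T_χ(𝓑^{T, χ∘det}) = T_χ(k·φ_{χ₂χ}) = k·(χ(−1)J(χ₂χ, χ)·φ_{χ₂})` — a submodule of the `T`-invariant line `k·φ_{χ₂}`
of «index» the principal ideal `(J(χ₂χ, χ))`.  Together with `map_twistOp_torusInvariants`: `T_χ` exchanges the two
torus lines with Jacobi-sum coefficients `J(χ₂, χ)`, `J(χ₂χ, χ)` (whose product is `χ(−1)·#F` on the new part).
[cite: IrelandRosen1990, Ch. 8 §3 Thm. 1] -/
theorem map_twistOp_torusEigenspace_quadratic (h12 : χ₁ * χ₂ = 1) (h1 : χ₁ ≠ 1) {χ : MulChar F k}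
    (hχ : χ⁻¹ = χ) (hχ1 : χ ≠ MulChar.ofUnitHom χ₁) (hχ2 : χ ≠ MulChar.ofUnitHom χ₂) :
    (torusEigenspace χ₁ χ₂ fun a b : Fˣ => χ (a : F) * χ (b : F)).map (twistOp χ₁ χ₂ χ) =
      k ∙ ((χ (-1) * jacobiSum (MulChar.ofUnitHom χ₂ * χ) χ) • torusFun χ₁ χ₂ (MulChar.ofUnitHom χ₂)) := by
  have hχχ : χ * χ = 1 := by
    nth_rw 1 [← hχ]
    exact inv_mul_cancel χ
  have hne : MulChar.ofUnitHom χ₂ * χ * χ ≠ 1 := by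
    rw [mul_assoc, hχχ, mul_one]
    exact ofUnitHom_ne_one χ₁ χ₂ h12 h1
  rw [torusEigenspace_quadratic_eq_span χ₁ χ₂ h12 hχ hχ1 hχ2, map_twistOp_span_torusFun χ₁ χ₂ χ _ hne,
    mul_assoc, hχχ, mul_one]

end TwistTorus

end GL2

end Literature.RepresentationTheory.FiniteGroups
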